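import Literature.NumberTheory.EllipticCurves.BSDSelmerCMPConverseGoldfeldProofs
import Literature.NumberTheory.EllipticCurves.BSDSelmerSmithDecomposition
import Literature.NumberTheory.EllipticCurves.QuadraticTwistHeegnerRootNumberProofs
import Literature.NumberTheory.EllipticCurves.RootNumberEvenAnalyticRankProofs
import Literature.NumberTheory.EllipticCurves.AnalyticRankOrderProofs
import Literature.NumberTheory.EllipticCurves.AnalyticRankModularityProofs
import Literature.NumberTheory.EllipticCurves.Rank1Residual.Predicates
import HarnessLib

set_option linter.dupNamespace false -- `Summit.BirchSwinnertonDyer.BirchSwinnertonDyer.Theorems.…` (summit = sub, D-0017)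
set_option autoImplicit false

/-!
# Crux `HeegnerTwistCouplingInSupply` (stmt-BirchSwinnertonDyer-21381, BED r503): the DENSITY-ONE SWITCH —
# the coupling follows from the printed inputs {Modularity, Monsky, Smith, Burungale–Tian} and ONE W-free
# class-group statement C⁺ («the p-indivisible Heegner discriminants of a level are not a null set»), BY VALUE

Route `BiquadraticEisensteinDescent` (cell `pub/bsd-wall`, row 12), line lead `bsd-line-ibd-p1` g2, 2026-08-28.
THEOREMS ONLY (no definition, no named fact, no `sorry`); imports NO `Theses` module: the crux text is spelled
out verbatim (rev 25), so the route file may cite the last theorem by `--glue-by` without an import cycle.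

The crux asks, for `(W, p)` in the CM inert-bad corner (analytic rank 1, `p ≥ 5`), for ONE imaginary quadratic
Heegner field `K′` of `N_W` with `|d_K′| > 4` carrying BOTH `L(W^{(d_K′)}, 1) ≠ 0` AND `p ∤ h(K′)`. Every earlier
line looked for an engine producing both at the same discriminant (none is in print at a residually
irreducible `p`). The observation typed here (crux idea card `goldfeld-density-one-switch`, crux-ideate seat 2
g8, whose `Cruxes/…/SketchIdeasSeat2G8.lean` this file turns into landed, importable theorems with the
missing parity and continuation steps supplied) is that NO coupling is needed: the `L`-half holds on a set of
square-free `d` of DENSITY ONE, so it meets every NON-NULL set.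

* `L`-half, density one (printed inputs, all named facts of the tree): Smith's `2^∞`-Selmer corank law
  `smith_selmerCorank_density W` (A. Smith, arXiv:2503.17619 Thm. 1.1; for CM `j ≠ 8000` already derived in the
  tree from the refereed J. Amer. Math. Soc. 39 (2026) papers, `BSDSelmerSmithCMTableProofs`) gives
  `corank ≤ 1` off a null set (`twistDensity_selmerCorankTwoInfty_le_one_of`); for a Heegner `d` the twist has
  root number `+1` (`rootNumber_quadraticTwist_discr_eq_neg_of_exists_isNewformOf` with `w(W) = (−1)^1`, both
  from the Modularity Theorem `exists_isNewformOf`), hence even analytic rank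
  (`even_analyticRank_iff_of_exists_isNewformOf`), hence even — so zero — `2^∞`-Selmer corank (Monsky's
  `2`-parity `monsky_selmerCorank_two_mod_two_eq`), hence analytic rank `0` by the Burungale–Tian rank-zero
  `2`-converse for the CM curve `W^{(d)}` (`burungaleTian_analyticRank_eq_zero_of_selmerCorank_eq_zero_of_hasCM`,
  Ann. of Math. 203 (2026) Thm. 1.1), hence `L(W^{(d)}, 1) ≠ 0` (`analyticRank_eq_zero_iff_holds` under the
  continuation `hasEntireLFunction_rat_of_exists_isNewformOf`).
* `h`-half, the RESIDUAL `C⁺(N, p)`: the set of `d ∈ ℤ` that are discriminants of imaginary quadratic fields `K`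
  with `|d| > 4`, every prime factor of `N` split in `K`, and `p ∤ h_K`, is NOT a `twistDensity`-zero set. It is
  W-free and `L`-free; it is OPEN for every `p ≥ 5` (Kohnen–Ono 1999 Thm. 1: `≫ √X / log X` such `d`, not
  non-null; positive proportion with local conditions is in print only at `ℓ = 3`, Davenport–Heilbronn /
  Nakagawa–Horie; Beckwith–Raum–Richter IMRN 2024 Thm. 1: existence); Cohen–Lenstra predicts relative density
  `∏_{k ≥ 1}(1 − p^{−k}) > 0`. Nothing here claims it.

Contents: `exists_heegnerField_twist_L_one_ne_zero_of_nonNull` (one curve: facts + Smith for `W` + C⁺(N_W, p) ⇒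
the crux's conclusion for `(W, p)`); `not_twistDensity_zero_of_twistDensity_pos` (any positive density gives C⁺);
`heegnerTwistCouplingInSupply_of_nonNull` (the crux TEXT, rev 25 verbatim, from the three facts, Smith for CM
curves, and C⁺ for all levels and all `p ≥ 5` — the ∀B class-number supply hypothesis of the crux is not used);
`heegnerTwistCouplingInSupply_of_printedInputs_of_nonNull` (the same with Smith's law itself unfolded into the
tree's printed inputs via `smith_selmerCorank_density_holds_of`). CONDITIONAL on the named facts listed (none is
discharged here) and on C⁺; asserts nothing about C⁺ or BSD. BSD is not proved by any of this.

References: [arXiv250317619] A. Smith, arXiv:2503.17619, Thm. 1.1, Thm. 1.17; [Smith2022SelmerTwistI] J. Amer. Math.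
Soc. 39 (2026); [BurungaleTian2026] Ann. of Math. (2) 203 (2026) 1–13, Thm. 1.1; [DokchitserDokchitserAnnals2010]
§4.6 (Monsky 1996); [BCDTJAMS2001] Thm. A; [Darmon2004] §3.6 Thm. 3.17; [KohnenOno1999] Invent. Math. 135, Thm. 1;
[BeckwithRaumRichter2024] IMRN 2024, Thm. 1.
-/

noncomputable section

open scoped Classical

open WeierstrassCurve Literature.NumberTheory.EllipticCurves
  Literature.NumberTheory.EllipticCurves.Rank1Residual

namespace Summit.BirchSwinnertonDyer.BirchSwinnertonDyer.Theorems.BiquadraticEisensteinDescentHeegnerTwistCouplingInSupplyDensityOneSwitch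

/-- **The density-one switch for ONE curve.** Let `W/ℚ` be elliptic with CM and `ord_{s=1} L(W, s) = 1`, and
`p : ℕ`. Grant the Modularity Theorem (`exists_isNewformOf`), the Burungale–Tian rank-zero `p`-converse for CM
curves (used at the prime `2` on the CM twists `W^{(d)}`), Monsky's `2`-parity, and Smith's `2^∞`-Selmer law for
`W`. If the `p`-indivisible Heegner discriminants of level `N_W` are NOT a null set of square-free integers
(C⁺(N_W, p)), then some imaginary quadratic Heegner field `K` of `N_W` with `|d_K| > 4` has
`L(W^{(d_K)}, 1) ≠ 0` and `p ∤ h_K`. Proof: off a null set the twist `W^{(d)}` has `2^∞`-Selmer corank `≤ 1`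
(Smith); on a Heegner `d` its root number is `−w(W) = +1` (Darmon 2004 Thm. 3.17 from modularity), so its
analytic rank is even, so its corank is even (Monsky), so `0`, so its analytic rank is `0` (Burungale–Tian for
the CM curve `W^{(d)}`), so `L(W^{(d)},1) ≠ 0` (continuation from modularity); a density-one set meets every
non-null set. [cite: arXiv250317619, Thm. 1.1] [cite: BurungaleTian2026, Thm. 1.1]
[cite: DokchitserDokchitserAnnals2010, §4.6] [cite: Darmon2004, §3.6 Thm. 3.17] [cite: BCDTJAMS2001, Thm. A] -/
theorem exists_heegnerField_twist_L_one_ne_zero_of_nonNull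
    (hmod : ModularForms.exists_isNewformOf)
    (hBT : burungaleTian_analyticRank_eq_zero_of_selmerCorank_eq_zero_of_hasCM)
    (hMon : monsky_selmerCorank_two_mod_two_eq)
    (W : WeierstrassCurve ℚ) [W.IsElliptic] (p : ℕ) (hCM : W.HasCM) (hr : W.analyticRank = 1)
    (hS : smith_selmerCorank_density W)
    (hC : ¬ twistDensity (fun d : ℤ ↦ ∃ (K : Type) (_ : Field K) (_ : NumberField K),
        IsImaginaryQuadratic K ∧ NumberField.discr K = d ∧ 4 < d.natAbs ∧
        SatisfiesHeegnerHypothesis (W.conductorNorm ℤ) K ∧ ¬ p ∣ NumberField.classNumber K) 0) :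
    ∃ (K : Type) (_ : Field K) (_ : NumberField K), IsImaginaryQuadratic K ∧
      4 < (NumberField.discr K).natAbs ∧ SatisfiesHeegnerHypothesis (W.conductorNorm ℤ) K ∧
      (W.quadraticTwist (NumberField.discr K : ℚ)).entireLFunction 1 ≠ 0 ∧
      ¬ p ∣ NumberField.classNumber K := by
  by_contra hno
  apply hC
  -- the density-one set `{d ≠ 0, corank_{ℤ₂} Sel_{2^∞}(W^d) ≤ 1}` (Smith) has a null complement
  have hc := (twistDensity_selmerCorankTwoInfty_le_one_of W hS).compl
  rw [sub_self] at hc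
  -- and the indivisible Heegner discriminants lie in that complement, since none of them is good
  refine hc.mono_zero fun d _ hI ↦ ?_
  intro hRd
  obtain ⟨K, iF, iN, hK, hdK, h4, hH, hh⟩ := hI
  obtain ⟨hd0, hle⟩ := hRd
  apply hno
  have hd' : ((d : ℤ) : ℚ) ≠ 0 := by exact_mod_cast hd0
  haveI := W.isElliptic_quadraticTwist hd'
  have hCMd : (W.quadraticTwist (d : ℚ)).HasCM := hasCM_quadraticTwist_of_hasCM W hCM hd'
  -- root numbers: w(W) = (-1)^1 = -1, w(W^{(d_K)}) = -w(W) = 1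
  have hwW : W.rootNumber = -1 := by
    rw [WeierstrassCurve.rootNumber_eq_neg_one_pow_analyticRank_of_exists_isNewformOf hmod W, hr]
    norm_num
  have hwd : (W.quadraticTwist (d : ℚ)).rootNumber = 1 := by
    have h := rootNumber_quadraticTwist_discr_eq_neg_of_exists_isNewformOf W K hmod hK hH
    rw [hdK] at h
    rw [h, hwW]
    norm_num
  -- even analytic rank, hence even (so zero) 2^∞-Selmer corank
  have hiff : Even (W.quadraticTwist (d : ℚ)).analyticRank ↔ (W.quadraticTwist (d : ℚ)).rootNumber = 1 :=
    WeierstrassCurve.even_analyticRank_iff_of_exists_isNewformOf hmod (W.quadraticTwist (d : ℚ))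
  obtain ⟨k, hk⟩ := hiff.2 hwd
  have hpar : (W.quadraticTwist (d : ℚ)).selmerCorank 2 % 2 =
      (W.quadraticTwist (d : ℚ)).analyticRank % 2 := hMon _
  rw [← selmerCorankTwoInfty_eq] at hpar
  have h0 : selmerCorankTwoInfty (W.quadraticTwist (d : ℚ)) = 0 := by omega
  -- Burungale–Tian at the prime 2 on the CM curve W^{(d)}: analytic rank 0, hence L(W^{(d)},1) ≠ 0
  have hr0 : (W.quadraticTwist (d : ℚ)).analyticRank = 0 :=
    hBT _ hCMd 2 ((selmerCorankTwoInfty_eq _).symm.trans h0)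
  have hL : (W.quadraticTwist (d : ℚ)).entireLFunction 1 ≠ 0 :=
    (WeierstrassCurve.analyticRank_eq_zero_iff_holds (W := W.quadraticTwist (d : ℚ))
      (WeierstrassCurve.hasEntireLFunction_rat_of_exists_isNewformOf hmod _)).1 hr0
  refine ⟨K, iF, iN, hK, ?_, hH, ?_, hh⟩
  · rw [hdK]; exact h4
  · rw [hdK]; exact hL

/-- **Any positive density gives C⁺**: if a set of square-free integers has `twistDensity` `δ > 0` it is not a
null set (limits in `ℝ` are unique). This is how a Cohen–Lenstra-type lower-density theorem for `p ∤ h` in a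
Heegner box (positive proportion with finitely many splitting conditions — in print only at `ℓ = 3`) would
discharge the residual hypothesis of `heegnerTwistCouplingInSupply_of_nonNull`. [folklore] -/
theorem not_twistDensity_zero_of_twistDensity_pos {P : ℤ → Prop} {δ : ℝ} (hP : twistDensity P δ)
    (hδ : 0 < δ) : ¬ twistDensity P 0 := by
  intro h0
  have h : δ = 0 := tendsto_nhds_unique hP h0
  exact hδ.ne' h

/-- **Crux `HeegnerTwistCouplingInSupply` (stmt-BirchSwinnertonDyer-21381) BY VALUE from printed inputs and C⁺.**
Hypotheses, in order: the Modularity Theorem `exists_isNewformOf` (BCDT 2001 Thm. A); the Burungale–Tian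
rank-zero `p`-converse for CM curves over `ℚ` (Ann. of Math. 203 (2026) Thm. 1.1, all primes — used at `2`);
Monsky's `2`-parity (Dokchitser–Dokchitser 2010 §4.6); Smith's `2^∞`-Selmer corank law for every CM curve over `ℚ`
(`smith_selmerCorank_density`, arXiv:2503.17619 Thm. 1.1; refereed for CM `j ≠ 8000` via the tree's CM table);
and the W-free RESIDUAL C⁺: for every level `N ≠ 0` and prime `p ≥ 5`, the discriminants of imaginary quadratic
fields `K` with `|d_K| > 4`, every `ℓ ∣ N` split in `K` and `p ∤ h_K` are not a null set of square-free integers.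
Conclusion = the text of `Theses.BiquadraticEisensteinDescent.HeegnerTwistCouplingInSupply` (rev 25) VERBATIM
(its hypotheses `CMInert`, `¬ Good`, `5 ≤ p` beyond `p ≥ 5` for C⁺, and the ∀B class-number supply are not used:
the density road needs no supply family). CONDITIONAL (gate class conditional-result); C⁺ is OPEN for `p ≥ 5`.
[cite: arXiv250317619, Thm. 1.1] [cite: BurungaleTian2026, Thm. 1.1] [cite: DokchitserDokchitserAnnals2010, §4.6]
[cite: BCDTJAMS2001, Thm. A] [cite: KohnenOno1999, Thm. 1] [cite: BeckwithRaumRichter2024, Thm. 1] -/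
theorem heegnerTwistCouplingInSupply_of_nonNull
    (hmod : ModularForms.exists_isNewformOf)
    (hBT : burungaleTian_analyticRank_eq_zero_of_selmerCorank_eq_zero_of_hasCM)
    (hMon : monsky_selmerCorank_two_mod_two_eq)
    (hS : ∀ (W : WeierstrassCurve ℚ) [W.IsElliptic], W.HasCM → smith_selmerCorank_density W)
    (hC : ∀ (N p : ℕ), N ≠ 0 → p.Prime → 5 ≤ p →
      ¬ twistDensity (fun d : ℤ ↦ ∃ (K : Type) (_ : Field K) (_ : NumberField K),
        IsImaginaryQuadratic K ∧ NumberField.discr K = d ∧ 4 < d.natAbs ∧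
        SatisfiesHeegnerHypothesis N K ∧ ¬ p ∣ NumberField.classNumber K) 0) :
    ∀ (W : WeierstrassCurve ℚ) [W.IsElliptic] [W.IsGloballyMinimal] (p : ℕ) [Fact p.Prime]
      [NeZero (W.conductorNorm ℤ)], W.HasCM → W.analyticRank = 1 → 5 ≤ p →
      Literature.NumberTheory.EllipticCurves.Rank1Residual.CMInert W p →
      ¬ Literature.NumberTheory.EllipticCurves.Rank1Residual.Good W p →
      (∀ B : ℕ, ∃ (K : Type) (_ : Field K) (_ : NumberField K),
        Literature.NumberTheory.EllipticCurves.IsImaginaryQuadratic K ∧ B < (NumberField.discr K).natAbs ∧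
        4 < (NumberField.discr K).natAbs ∧
        Literature.NumberTheory.EllipticCurves.SatisfiesHeegnerHypothesis (W.conductorNorm ℤ) K ∧
        ¬ p ∣ NumberField.classNumber K) →
      ∃ (K : Type) (_ : Field K) (_ : NumberField K),
        Literature.NumberTheory.EllipticCurves.IsImaginaryQuadratic K ∧ 4 < (NumberField.discr K).natAbs ∧
        Literature.NumberTheory.EllipticCurves.SatisfiesHeegnerHypothesis (W.conductorNorm ℤ) K ∧
        (W.quadraticTwist (NumberField.discr K : ℚ)).entireLFunction 1 ≠ 0 ∧
        ¬ p ∣ NumberField.classNumber K := by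
  intro W _ _ p hp hN hCM hr hp5 _ _ _
  exact exists_heegnerField_twist_L_one_ne_zero_of_nonNull hmod hBT hMon W p hCM hr (hS W hCM)
    (hC _ p hN.out hp.out hp5)

/-- **The same, with Smith's law unfolded into the tree's printed inputs** (`smith_selmerCorank_density_holds_of`:
the Modularity Theorem, Monsky's `2`-parity, the refereed Smith 2022 distribution theorem
`smith2022_selmerCorank_distribution` (J. Amer. Math. Soc. 39 (2026), Thm. 1.2 / Assumption 1.1) and Smith's
arXiv:2503.17619 Thm. 1.17 in Cases IV and V): the crux text from six named facts and C⁺. This is the shape of a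
by-name split of stmt-21381 into auto-held print-input children + ONE W-free crux child C⁺, glued by this theorem.
[cite: arXiv250317619, Thm. 1.1, Thm. 1.17] [cite: Smith2022SelmerTwistI, Thm. 1.2] [cite: BurungaleTian2026, Thm. 1.1]
[cite: DokchitserDokchitserAnnals2010, §4.6] [cite: BCDTJAMS2001, Thm. A] -/
theorem heegnerTwistCouplingInSupply_of_printedInputs_of_nonNull
    (hmod : ModularForms.exists_isNewformOf)
    (hBT : burungaleTian_analyticRank_eq_zero_of_selmerCorank_eq_zero_of_hasCM)
    (hMon : monsky_selmerCorank_two_mod_two_eq)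
    (h22 : smith2022_selmerCorank_distribution) (h17IV : smith2025_thm117_caseIV)
    (h17V : smith2025_thm117_caseV)
    (hC : ∀ (N p : ℕ), N ≠ 0 → p.Prime → 5 ≤ p →
      ¬ twistDensity (fun d : ℤ ↦ ∃ (K : Type) (_ : Field K) (_ : NumberField K),
        IsImaginaryQuadratic K ∧ NumberField.discr K = d ∧ 4 < d.natAbs ∧
        SatisfiesHeegnerHypothesis N K ∧ ¬ p ∣ NumberField.classNumber K) 0) :
    ∀ (W : WeierstrassCurve ℚ) [W.IsElliptic] [W.IsGloballyMinimal] (p : ℕ) [Fact p.Prime]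
      [NeZero (W.conductorNorm ℤ)], W.HasCM → W.analyticRank = 1 → 5 ≤ p →
      Literature.NumberTheory.EllipticCurves.Rank1Residual.CMInert W p →
      ¬ Literature.NumberTheory.EllipticCurves.Rank1Residual.Good W p →
      (∀ B : ℕ, ∃ (K : Type) (_ : Field K) (_ : NumberField K),
        Literature.NumberTheory.EllipticCurves.IsImaginaryQuadratic K ∧ B < (NumberField.discr K).natAbs ∧
        4 < (NumberField.discr K).natAbs ∧
        Literature.NumberTheory.EllipticCurves.SatisfiesHeegnerHypothesis (W.conductorNorm ℤ) K ∧
        ¬ p ∣ NumberField.classNumber K) →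
      ∃ (K : Type) (_ : Field K) (_ : NumberField K),
        Literature.NumberTheory.EllipticCurves.IsImaginaryQuadratic K ∧ 4 < (NumberField.discr K).natAbs ∧
        Literature.NumberTheory.EllipticCurves.SatisfiesHeegnerHypothesis (W.conductorNorm ℤ) K ∧
        (W.quadraticTwist (NumberField.discr K : ℚ)).entireLFunction 1 ≠ 0 ∧
        ¬ p ∣ NumberField.classNumber K :=
  heegnerTwistCouplingInSupply_of_nonNull hmod hBT hMon
    (fun W _ _ ↦ smith_selmerCorank_density_holds_of hmod hMon h22 h17IV h17V W) hC

end Summit.BirchSwinnertonDyer.BirchSwinnertonDyer.Theorems.BiquadraticEisensteinDescentHeegnerTwistCouplingInSupplyDensityOneSwitch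

end
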